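import Mathlib
import HarnessLib
import Literature.MathematicalPhysics.QuantumLattice.KohnLuttinger
import Literature.MathematicalPhysics.QuantumLattice.KohnLuttingerLindhardMeasurable
import Summits.HubbardSuperconductivity.HubbardSuperconductivity.Theses.ChiralWindow
import Summits.HubbardSuperconductivity.HubbardSuperconductivity.Theorems.WeakCouplingBCSWcbcsKohnLuttingerB1gReduction

/-!
# Route `ChiralWindow`, support `CwChannelInfContinuous` (item `stmt-HubbardSuperconductivity-1744`):
the filling of the square-lattice band

Helper file for `CwChannelInfContinuous` (continuity of `δ ↦ channelInf ε (μ(1-δ)) U χ` on the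
doping window `[1/4, 12/25]`, `ε = squareDispersion 1 0`, `μ(n) = chemicalPotentialOfDensity ε n`).
This file settles the innermost layer of that statement, the map `n ↦ μ(n)`:

* (using `Literature…volume_levelSet_squareDispersion`: level sets of `ε` are Lebesgue-null)
  `filling_eq` — `filling ε μ = 2 · vol(BZ ∩ {ε < μ}) / (2π)²`, hence (`continuous_filling`,
  `monotone_filling`, `strictMonoOn_filling`) the filling is continuous, monotone, and strictly
  increasing across the band `[-4, 4]`, with `filling ε μ = 0` for `μ ≤ -4` and `3/4 < filling ε 0`
  (the open diamond `|k₀| + |k₁| < π`, of area `2π²`, lies in the Fermi sea at `μ = 0`).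

No new definitions. [folklore]
-/

noncomputable section

open MeasureTheory Real Set Filter Topology
open scoped ENNReal

-- the tree's namespace `Summit.<Summit>.<Problem>.Theorems` repeats the summit name by design (D-0017)
set_option linter.dupNamespace false

namespace Summit.HubbardSuperconductivity.HubbardSuperconductivity.Theorems

open Literature.MathematicalPhysics.QuantumLattice

/-! ### The dispersion `ε = squareDispersion 1 0` -/

/-- Unfolding `squareDispersion 1 0 k = -2 (cos k₀ + cos k₁)`. [folklore] -/
theorem squareDispersion_one_zero_apply (k : Momentum) :
    squareDispersion 1 0 k = -2 * (cos (k 0) + cos (k 1)) := by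
  simp [squareDispersion]

/-- The band bottom: `-4 ≤ ε`. [folklore] -/
theorem neg_four_le_squareDispersion (k : Momentum) : -4 ≤ squareDispersion 1 0 k := by
  rw [squareDispersion_one_zero_apply]
  have h0 := cos_le_one (k 0); have h1 := cos_le_one (k 1)
  linarith

/-- The band top: `ε ≤ 4`. [folklore] -/
theorem squareDispersion_le_four (k : Momentum) : squareDispersion 1 0 k ≤ 4 := by
  rw [squareDispersion_one_zero_apply]
  have h0 := neg_one_le_cos (k 0); have h1 := neg_one_le_cos (k 1)
  linarith

/-- The sub-level sets `{ε < μ}` are open, hence measurable. [folklore] -/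
theorem measurableSet_lt_squareDispersion (t t' μ : ℝ) :
    MeasurableSet {p : Momentum | squareDispersion t t' p < μ} :=
  (isOpen_lt (continuous_squareDispersion t t') continuous_const).measurableSet

/-! ### Level sets of the dispersion are null -/

/-! ### The filling as a volume -/

/-- The Fermi sea volume `vol(BZ ∩ {ε < μ})` (an auxiliary spelling used only in this file's
statements through `filling_eq`). [folklore] -/
theorem filling_eq (μ : ℝ) :
    KohnLuttinger.filling (squareDispersion 1 0) μ =
      2 * (volume (brillouinZone ∩ {p : Momentum | squareDispersion 1 0 p < μ})).toReal /
        (2 * π) ^ 2 := by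
  unfold KohnLuttinger.filling
  have hind : (fermiOccupation (squareDispersion 1 0) μ) =
      {p : Momentum | squareDispersion 1 0 p < μ}.indicator (fun _ => (1 : ℝ)) := by
    funext p
    simp only [fermiOccupation, Set.indicator_apply, mem_setOf_eq]
  rw [hind, integral_indicator_const (1 : ℝ) (measurableSet_lt_squareDispersion 1 0 μ),
    smul_eq_mul, mul_one, measureReal_def,
    Measure.restrict_apply (measurableSet_lt_squareDispersion 1 0 μ), inter_comm]

/-- The Fermi sea volume is finite. [folklore] -/
theorem volume_fermiSea_lt_top (μ : ℝ) :
    volume (brillouinZone ∩ {p : Momentum | squareDispersion 1 0 p < μ}) < ⊤ :=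
  (measure_mono inter_subset_left).trans_lt volume_brillouinZone_lt_top

/-- The Fermi sea volume is monotone in `μ`. [folklore] -/
theorem monotone_volume_fermiSea :
    Monotone fun μ : ℝ => volume (brillouinZone ∩ {p : Momentum | squareDispersion 1 0 p < μ}) := by
  intro a b hab
  exact measure_mono (inter_subset_inter_right _ fun p (hp : _ < a) => hp.trans_le hab)

/-- Right limits of the Fermi sea volume: along `μ₀ + 1/(n+1)` the volumes tend to the volume at
`μ₀` (the sub-level sets decrease to `{ε ≤ μ₀}`, which differs from `{ε < μ₀}` by a null level set).
[folklore] -/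
theorem tendsto_volume_fermiSea_right (μ₀ : ℝ) :
    Tendsto (fun n : ℕ => volume (brillouinZone ∩
        {p : Momentum | squareDispersion 1 0 p < μ₀ + 1 / ((n : ℝ) + 1)})) atTop
      (𝓝 (volume (brillouinZone ∩ {p : Momentum | squareDispersion 1 0 p < μ₀}))) := by
  set s : ℕ → Set Momentum := fun n =>
    brillouinZone ∩ {p : Momentum | squareDispersion 1 0 p < μ₀ + 1 / ((n : ℝ) + 1)} with hs
  have hanti : Antitone s := by
    intro m n hmn
    refine inter_subset_inter_right _ fun p hp => ?_
    simp only [mem_setOf_eq] at hp ⊢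
    have : (1 : ℝ) / ((n : ℝ) + 1) ≤ 1 / ((m : ℝ) + 1) :=
      one_div_le_one_div_of_le (by positivity) (by exact_mod_cast Nat.succ_le_succ hmn)
    linarith
  have hmeas : ∀ n, NullMeasurableSet (s n) volume := fun n =>
    (measurableSet_brillouinZone.inter (measurableSet_lt_squareDispersion 1 0 _)).nullMeasurableSet
  have hfin : ∃ n, volume (s n) ≠ ⊤ := ⟨0, (volume_fermiSea_lt_top _).ne⟩
  have hlim := tendsto_measure_iInter_atTop (μ := volume) hmeas hanti hfin
  have hInter : ⋂ n, s n = brillouinZone ∩ {p : Momentum | squareDispersion 1 0 p ≤ μ₀} := by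
    ext p
    simp only [hs, mem_iInter, mem_inter_iff, mem_setOf_eq]
    constructor
    · intro h
      refine ⟨(h 0).1, le_of_forall_pos_lt_add fun e he => ?_⟩
      obtain ⟨n, hn⟩ := exists_nat_one_div_lt he
      have := (h n).2
      linarith
    · intro h n
      exact ⟨h.1, h.2.trans_lt (by simp; positivity)⟩
  have hsplit : brillouinZone ∩ {p : Momentum | squareDispersion 1 0 p ≤ μ₀} =
      (brillouinZone ∩ {p : Momentum | squareDispersion 1 0 p < μ₀}) ∪
        (brillouinZone ∩ {p : Momentum | squareDispersion 1 0 p = μ₀}) := by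
    ext p
    simp only [mem_inter_iff, mem_setOf_eq, mem_union]
    constructor
    · rintro ⟨hB, hle⟩
      rcases hle.lt_or_eq with h | h
      · exact Or.inl ⟨hB, h⟩
      · exact Or.inr ⟨hB, h⟩
    · rintro (⟨hB, h⟩ | ⟨hB, h⟩)
      · exact ⟨hB, h.le⟩
      · exact ⟨hB, h.le⟩
  have hnull : volume (brillouinZone ∩ {p : Momentum | squareDispersion 1 0 p = μ₀}) = 0 :=
    measure_mono_null inter_subset_right (volume_levelSet_squareDispersion μ₀)
  have hval : volume (⋂ n, s n) =
      volume (brillouinZone ∩ {p : Momentum | squareDispersion 1 0 p < μ₀}) := by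
    rw [hInter, hsplit]
    apply le_antisymm
    · calc volume (brillouinZone ∩ {p : Momentum | squareDispersion 1 0 p < μ₀} ∪
            brillouinZone ∩ {p : Momentum | squareDispersion 1 0 p = μ₀})
          ≤ volume (brillouinZone ∩ {p : Momentum | squareDispersion 1 0 p < μ₀}) +
            volume (brillouinZone ∩ {p : Momentum | squareDispersion 1 0 p = μ₀}) :=
            measure_union_le _ _
        _ = volume (brillouinZone ∩ {p : Momentum | squareDispersion 1 0 p < μ₀}) := by
            rw [hnull, add_zero]
    · exact measure_mono subset_union_left
  rw [hval] at hlim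
  exact hlim

/-- Left limits of the Fermi sea volume: along `μ₀ - 1/(n+1)` the volumes tend to the volume at `μ₀`
(the sub-level sets increase to `{ε < μ₀}`). [folklore] -/
theorem tendsto_volume_fermiSea_left (μ₀ : ℝ) :
    Tendsto (fun n : ℕ => volume (brillouinZone ∩
        {p : Momentum | squareDispersion 1 0 p < μ₀ - 1 / ((n : ℝ) + 1)})) atTop
      (𝓝 (volume (brillouinZone ∩ {p : Momentum | squareDispersion 1 0 p < μ₀}))) := by
  set s : ℕ → Set Momentum := fun n =>
    brillouinZone ∩ {p : Momentum | squareDispersion 1 0 p < μ₀ - 1 / ((n : ℝ) + 1)} with hs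
  have hmono : Monotone s := by
    intro m n hmn
    refine inter_subset_inter_right _ fun p hp => ?_
    simp only [mem_setOf_eq] at hp ⊢
    have : (1 : ℝ) / ((n : ℝ) + 1) ≤ 1 / ((m : ℝ) + 1) :=
      one_div_le_one_div_of_le (by positivity) (by exact_mod_cast Nat.succ_le_succ hmn)
    linarith
  have hlim := tendsto_measure_iUnion_atTop (μ := volume) hmono
  have hUnion : ⋃ n, s n = brillouinZone ∩ {p : Momentum | squareDispersion 1 0 p < μ₀} := by
    ext p
    simp only [hs, mem_iUnion, mem_inter_iff, mem_setOf_eq]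
    constructor
    · rintro ⟨n, hB, hlt⟩
      exact ⟨hB, hlt.trans_le (by simp; positivity)⟩
    · rintro ⟨hB, hlt⟩
      obtain ⟨n, hn⟩ := exists_nat_one_div_lt (sub_pos.2 hlt)
      exact ⟨n, hB, by linarith⟩
  rw [hUnion] at hlim
  exact hlim

/-- **The Fermi sea volume is continuous in `μ`** (monotone with matching one-sided limits).
[folklore] -/
theorem continuous_volume_fermiSea :
    Continuous fun μ : ℝ => volume (brillouinZone ∩ {p : Momentum | squareDispersion 1 0 p < μ}) := by
  set g : ℝ → ℝ≥0∞ := fun μ => volume (brillouinZone ∩ {p : Momentum | squareDispersion 1 0 p < μ})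
    with hg
  have hmono : Monotone g := monotone_volume_fermiSea
  refine continuous_iff_continuousAt.2 fun μ₀ => ?_
  rw [hmono.continuousAt_iff_leftLim_eq_rightLim]
  -- the sequences `μ₀ ∓ 1/(n+1)` tend to `μ₀` from the left / right
  have hseqL : Tendsto (fun n : ℕ => μ₀ - 1 / ((n : ℝ) + 1)) atTop (𝓝[<] μ₀) := by
    rw [tendsto_nhdsWithin_iff]
    refine ⟨?_, Filter.Eventually.of_forall fun n => ?_⟩
    · have : Tendsto (fun n : ℕ => μ₀ - 1 / ((n : ℝ) + 1)) atTop (𝓝 (μ₀ - 0)) :=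
        tendsto_const_nhds.sub tendsto_one_div_add_atTop_nhds_zero_nat
      rwa [sub_zero] at this
    · show μ₀ - 1 / ((n : ℝ) + 1) < μ₀
      simp; positivity
  have hseqR : Tendsto (fun n : ℕ => μ₀ + 1 / ((n : ℝ) + 1)) atTop (𝓝[>] μ₀) := by
    rw [tendsto_nhdsWithin_iff]
    refine ⟨?_, Filter.Eventually.of_forall fun n => ?_⟩
    · have : Tendsto (fun n : ℕ => μ₀ + 1 / ((n : ℝ) + 1)) atTop (𝓝 (μ₀ + 0)) :=
        tendsto_const_nhds.add tendsto_one_div_add_atTop_nhds_zero_nat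
      rwa [add_zero] at this
    · show μ₀ < μ₀ + 1 / ((n : ℝ) + 1)
      simp; positivity
  have hL : Function.leftLim g μ₀ = g μ₀ :=
    tendsto_nhds_unique ((hmono.tendsto_leftLim μ₀).comp hseqL) (tendsto_volume_fermiSea_left μ₀)
  have hR : Function.rightLim g μ₀ = g μ₀ :=
    tendsto_nhds_unique ((hmono.tendsto_rightLim μ₀).comp hseqR) (tendsto_volume_fermiSea_right μ₀)
  rw [hL, hR]

/-! ### Continuity and monotonicity of the filling -/

/-- **The filling is continuous in the chemical potential.** [folklore] -/
theorem continuous_filling : Continuous (KohnLuttinger.filling (squareDispersion 1 0)) := by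
  have h : KohnLuttinger.filling (squareDispersion 1 0) = fun μ =>
      2 * (volume (brillouinZone ∩ {p : Momentum | squareDispersion 1 0 p < μ})).toReal /
        (2 * π) ^ 2 := funext filling_eq
  rw [h]
  have ht : Continuous fun μ : ℝ =>
      (volume (brillouinZone ∩ {p : Momentum | squareDispersion 1 0 p < μ})).toReal := by
    refine continuous_iff_continuousAt.2 fun μ₀ => ?_
    have h1 := continuous_volume_fermiSea.continuousAt (x := μ₀)
    have h2 := ENNReal.continuousAt_toReal (volume_fermiSea_lt_top μ₀).ne
    exact h2.tendsto.comp h1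
  fun_prop

/-- The filling is monotone in the chemical potential. [folklore] -/
theorem monotone_filling : Monotone (KohnLuttinger.filling (squareDispersion 1 0)) := by
  intro a b hab
  rw [filling_eq, filling_eq]
  have h := ENNReal.toReal_mono (volume_fermiSea_lt_top b).ne (monotone_volume_fermiSea hab)
  have hπ : 0 < (2 * π) ^ 2 := by positivity
  exact div_le_div_of_nonneg_right (by linarith) hπ.le

/-- Below the band the Fermi sea is empty: `filling ε μ = 0` for `μ ≤ -4`. [folklore] -/
theorem filling_of_le_neg_four {μ : ℝ} (hμ : μ ≤ -4) :
    KohnLuttinger.filling (squareDispersion 1 0) μ = 0 := by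
  rw [filling_eq]
  have : brillouinZone ∩ {p : Momentum | squareDispersion 1 0 p < μ} = ∅ := by
    ext p
    simp only [mem_inter_iff, mem_setOf_eq, mem_empty_iff_false, iff_false, not_and, not_lt]
    exact fun _ => hμ.trans (neg_four_le_squareDispersion p)
  rw [this, measure_empty, ENNReal.toReal_zero, mul_zero, zero_div]

/-- The open box `(-π, π)²` is an open subset of the Brillouin zone. [folklore] -/
theorem isOpen_openBox : IsOpen {k : Momentum | ∀ i, k i ∈ Ioo (-π) π} := by
  have : {k : Momentum | ∀ i, k i ∈ Ioo (-π) π} = ⋂ i : Fin 2, (fun k : Momentum => k i) ⁻¹' Ioo (-π) π := by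
    ext k; simp
  rw [this]
  exact isOpen_iInter_of_finite fun i => isOpen_Ioo.preimage (PiLp.continuous_apply 2 _ i)

/-- The open box `(-π, π)²` lies in the Brillouin zone. [folklore] -/
theorem openBox_subset_brillouinZone :
    {k : Momentum | ∀ i, k i ∈ Ioo (-π) π} ⊆ brillouinZone :=
  fun _ hk i => Ioo_subset_Ico_self (hk i)

/-- **The filling is strictly increasing across the band**: `StrictMonoOn (filling ε) [-4, 4]`
(between two levels `a < b` of `[-4, 4]` there is an open non-empty slab `{a < ε < b}` of the open
box, of positive volume). [folklore] -/
theorem strictMonoOn_filling :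
    StrictMonoOn (KohnLuttinger.filling (squareDispersion 1 0)) (Icc (-4) 4) := by
  intro a ha b hb hab
  rw [filling_eq, filling_eq]
  have hπ : 0 < (2 * π) ^ 2 := by positivity
  apply div_lt_div_of_pos_right _ hπ
  refine mul_lt_mul_of_pos_left ?_ two_pos
  apply ENNReal.toReal_strict_mono (volume_fermiSea_lt_top b).ne
  -- the slab `{a < ε < b}` inside the open box
  set O : Set Momentum := {k : Momentum | ∀ i, k i ∈ Ioo (-π) π} ∩
    {p | a < squareDispersion 1 0 p ∧ squareDispersion 1 0 p < b} with hO
  have hOopen : IsOpen O := by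
    refine isOpen_openBox.inter ?_
    have : {p : Momentum | a < squareDispersion 1 0 p ∧ squareDispersion 1 0 p < b} =
        squareDispersion 1 0 ⁻¹' Ioo a b := by ext p; simp
    rw [this]
    exact isOpen_Ioo.preimage (continuous_squareDispersion 1 0)
  -- a point of the slab on the diagonal: `k = (-s, -s)` with `-4 cos s = (a + b)/2`
  have hOne : O.Nonempty := by
    set c : ℝ := -((a + b) / 8) with hc
    have hc1 : -1 < c := by rw [hc]; linarith [ha.1, hb.2, ha.2, hb.1]
    have hc2 : c < 1 := by rw [hc]; linarith [ha.1, hb.2, ha.2, hb.1]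
    set s : ℝ := arccos c with hs
    have hs0 : 0 < s := Real.arccos_pos.2 hc2
    have hsπ : s < π := by
      rcases (Real.arccos_le_pi c).lt_or_eq with h | h
      · exact h
      · exact absurd (Real.arccos_eq_pi.1 h) (not_le.2 hc1)
    have hcos : cos s = c := Real.cos_arccos hc1.le hc2.le
    refine ⟨WithLp.toLp 2 ![-s, -s], ?_, ?_⟩
    · intro i
      fin_cases i <;> simp <;> constructor <;> linarith
    · simp only [mem_setOf_eq, squareDispersion_one_zero_apply,
        Matrix.cons_val_zero, Matrix.cons_val_one, cos_neg, hcos, hc]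
      constructor <;> linarith
  have hOpos : 0 < volume O := hOopen.measure_pos volume hOne
  have hOsub : O ⊆ brillouinZone ∩ {p : Momentum | squareDispersion 1 0 p < b} :=
    fun p hp => ⟨openBox_subset_brillouinZone hp.1, hp.2.2⟩
  have hdisj : Disjoint (brillouinZone ∩ {p : Momentum | squareDispersion 1 0 p < a}) O := by
    rw [Set.disjoint_left]
    rintro p ⟨-, hpa⟩ ⟨-, hap, -⟩
    exact lt_irrefl _ ((hpa : squareDispersion 1 0 p < a).trans hap)
  have hOmeas : MeasurableSet O := hOopen.measurableSet
  calc volume (brillouinZone ∩ {p : Momentum | squareDispersion 1 0 p < a})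
      < volume (brillouinZone ∩ {p : Momentum | squareDispersion 1 0 p < a}) + volume O :=
        ENNReal.lt_add_right (volume_fermiSea_lt_top a).ne hOpos.ne'
    _ = volume ((brillouinZone ∩ {p : Momentum | squareDispersion 1 0 p < a}) ∪ O) :=
        (measure_union hdisj hOmeas).symm
    _ ≤ volume (brillouinZone ∩ {p : Momentum | squareDispersion 1 0 p < b}) :=
        measure_mono (union_subset (inter_subset_inter_right _ fun p (hp : _ < a) =>
          hp.trans hab) hOsub)

end Summit.HubbardSuperconductivity.HubbardSuperconductivity.Theorems

end
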